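import Summits.CriticalPhenomena.CardyFormulaZ2.Theorems.CardyBoundaryCoulombGasHalfPlaneMarkDensityLawDensityIdentification

/-!
# `HalfPlaneMarkDensityLaw` (crux stmt-CriticalPhenomena-5661), line `Sketch`:
# UNIFORM constants and JOINT CONTINUITY of the fourth-mark derivative of joint limits (lead c4-0)

`P_n(a,b,c,y)` = CDF, `lawSeq a b c x n = n · P_{1/2}[E_n(a,b,c,x)]` = the crux's sequence (lattice mark
density of critical bond percolation on `ℤ²` in the half-plane).

* `uniformShiftLipschitz` — the `n⁻²`-Lipschitz bound of the line (stub L) with a constant depending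
  on the marks ONLY through a lower bound `4ε` on the gaps `b − a`, `c − b`, `x₀ − c` (the landed
  `shiftLipschitz` hides this uniformity behind an `∃ C` per quadruple; the proof is its proof with the
  quantifiers exchanged: radius `R = ⌊εn⌋₊`, one-step bound `3C_A²/R²` from `Shift.abs_sub_succ_le`,
  telescoping, crude bound below the threshold `n₀ = ⌈2/ε⌉`).
* `uniformDensityRegularity` — hence the constant of `densityRegularity` (second-order Taylor bounds of
  the limit CDF, Lipschitz bound of the density limits) is uniform over `4ε`-separated marks.
* `continuousOn_deriv₄_jointLimit` — for every joint subsequential limit `G` (along a strictly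
  increasing `θ`), the fourth-mark derivative `(a,b,c,x) ↦ ∂₄G(a,b,c,x)` — which exists and is the limit
  along `θ` of the crux's sequence (`hasDerivAt_jointLimit`) — is JOINTLY CONTINUOUS on the chamber
  `{a < b < c < x}`: uniform Taylor bounds + joint continuity of `G` (`continuousOn_of_jointLimit`,
  c2-0) in the three source/gap marks, uniform Lipschitz bound in the fourth.  With
  `hasDerivAt_jointLimit_first` the same holds for the first-mark derivative
  (`continuousOn_deriv₁_jointLimit`).

So every joint subsequential scaling limit of the half-plane four-arc crossing probability of bond-`ℤ²`
is continuously differentiable in each OUTER mark on the whole chamber, the partial derivatives being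
(reflections of) subsequential scaling limits of the crux's mark density.
-/

noncomputable section

namespace Summit.CriticalPhenomena.CardyFormulaZ2.Cruxes.HalfPlaneMarkDensityLaw.SketchLine

open Literature.Probability.Percolation Literature.Probability.LatticeModels
open MeasureTheory Filter Set
open scoped Topology
open Summit.CriticalPhenomena.CardyFormulaZ2.Theorems.HalfPlaneMarkDensityLaw.Negative

namespace Density

/-! ### The `n⁻²`-Lipschitz bound with a uniform constant -/

/-- **Uniform `n⁻²`-Lipschitz bound.** For every `ε > 0` there is `C ≥ 0` such that for ALL marks with
`4ε ≤ b − a`, `4ε ≤ c − b`, `4ε ≤ x₀ − c`, all `n ≥ 1` and all sites `⌊x₀n⌋ ≤ k ≤ k'`: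
`|P[E(k')] − P[E(k)]| ≤ C (k' − k)/n²`, `E(k) = firstHit halfPlane A_n ⌊cn⌋ k`. [folklore] -/
theorem uniformShiftLipschitz {ε : ℝ} (hε : 0 < ε) :
    ∃ C : ℝ, 0 ≤ C ∧ ∀ a b c x₀ : ℝ, 4 * ε ≤ b - a → 4 * ε ≤ c - b → 4 * ε ≤ x₀ - c →
      ∀ n : ℕ, 1 ≤ n → ∀ k k' : ℤ, ⌊x₀ * n⌋ ≤ k → k ≤ k' →
        |μ.real (firstHit halfPlane (arcA a b n) ⌊c * n⌋ k') -
            μ.real (firstHit halfPlane (arcA a b n) ⌊c * n⌋ k)| ≤ C * (k' - k) / (n : ℝ) ^ 2 := by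
  obtain ⟨C_A, hA⟩ := stub_twoArmPoint
  have hC : 0 ≤ C_A := by
    have h := (hA 0 1 le_rfl).1
    rw [Nat.cast_one (R := ℝ), div_one] at h
    exact measureReal_nonneg.trans h
  -- threshold `n₀`: for `n ≥ n₀`, `ε n ≥ 2`
  obtain ⟨n₀, hn₀⟩ := exists_nat_ge (2 / ε)
  have hK₀ : 0 ≤ 12 * C_A ^ 2 / ε ^ 2 := by positivity
  refine ⟨12 * C_A ^ 2 / ε ^ 2 + (n₀ : ℝ) ^ 2, by positivity,
    fun a b c x₀ hεab hεbc hεcx n hn k k' hk hkk' ↦ ?_⟩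
  have hn' : (0 : ℝ) < n := Nat.cast_pos.2 hn
  obtain ⟨m, rfl⟩ : ∃ m : ℕ, k' = k + m := ⟨(k' - k).toNat, by omega⟩
  rcases lt_or_ge n n₀ with hlt | hge
  · -- small `n`: the crude bound `|g n k' − g n k| ≤ 1`
    rcases Nat.eq_zero_or_pos m with rfl | hm
    · simp
    have hu₁ : μ.real (firstHit halfPlane (arcA a b n) ⌊c * n⌋ (k + m)) ≤ 1 := measureReal_le_one
    have hu₂ : μ.real (firstHit halfPlane (arcA a b n) ⌊c * n⌋ k) ≤ 1 := measureReal_le_one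
    have hl₁ : 0 ≤ μ.real (firstHit halfPlane (arcA a b n) ⌊c * n⌋ (k + m)) := measureReal_nonneg
    have hl₂ : 0 ≤ μ.real (firstHit halfPlane (arcA a b n) ⌊c * n⌋ k) := measureReal_nonneg
    have h1 : |μ.real (firstHit halfPlane (arcA a b n) ⌊c * n⌋ (k + m)) -
        μ.real (firstHit halfPlane (arcA a b n) ⌊c * n⌋ k)| ≤ 1 := by
      rw [abs_sub_le_iff]; constructor <;> linarith
    refine h1.trans ?_
    rw [le_div_iff₀ (by positivity), one_mul]
    have hm1 : (1 : ℝ) ≤ m := by exact_mod_cast hm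
    have hnn₀ : (n : ℝ) ^ 2 ≤ (n₀ : ℝ) ^ 2 := by
      have : (n : ℝ) ≤ n₀ := by exact_mod_cast hlt.le
      exact pow_le_pow_left₀ hn'.le this 2
    calc (n : ℝ) ^ 2 ≤ (n₀ : ℝ) ^ 2 := hnn₀
      _ ≤ 12 * C_A ^ 2 / ε ^ 2 + (n₀ : ℝ) ^ 2 := le_add_of_nonneg_left hK₀
      _ ≤ (12 * C_A ^ 2 / ε ^ 2 + (n₀ : ℝ) ^ 2) * (m : ℝ) :=
        le_mul_of_one_le_right (by positivity) hm1
      _ = _ := by push_cast; ring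
  · -- large `n`: `ε n ≥ 2`, radius `R = ⌊ε n⌋₊ ≥ 1`
    have hεn : 2 ≤ ε * n := by
      have h1 : (n₀ : ℝ) ≤ n := by exact_mod_cast hge
      have h2 := (div_le_iff₀ hε).1 (hn₀.trans h1)
      linarith
    set R : ℕ := ⌊ε * n⌋₊ with hR_def
    have hRle : (R : ℝ) ≤ ε * n := Nat.floor_le (by positivity)
    have hRlt : ε * n < R + 1 := Nat.lt_floor_add_one _
    have hR1 : 1 ≤ R := by
      rw [hR_def, Nat.one_le_floor_iff]
      linarith
    have hR1' : (1 : ℝ) ≤ R := by exact_mod_cast hR1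
    have hαle : (⌊a * n⌋ : ℝ) ≤ a * n := Int.floor_le _
    have hβlt : b * n < ⌊b * n⌋ + 1 := Int.lt_floor_add_one _
    have hβle : (⌊b * n⌋ : ℝ) ≤ b * n := Int.floor_le _
    have hγlt : c * n < ⌊c * n⌋ + 1 := Int.lt_floor_add_one _
    have hγle : (⌊c * n⌋ : ℝ) ≤ c * n := Int.floor_le _
    have hxlt : x₀ * n < ⌊x₀ * n⌋ + 1 := Int.lt_floor_add_one _
    have hab' : 4 * ε * n ≤ (b - a) * n := mul_le_mul_of_nonneg_right hεab hn'.le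
    have hbc' : 4 * ε * n ≤ (c - b) * n := mul_le_mul_of_nonneg_right hεbc hn'.le
    have hcx' : 4 * ε * n ≤ (x₀ - c) * n := mul_le_mul_of_nonneg_right hεcx hn'.le
    have h₁ : (R : ℤ) ≤ ⌊b * n⌋ - ⌊a * n⌋ + 1 := by
      have h : (R : ℝ) < ⌊b * n⌋ - ⌊a * n⌋ + 1 := by linarith
      have h' : (R : ℤ) < ⌊b * n⌋ - ⌊a * n⌋ + 1 := by exact_mod_cast h
      omega
    have h₂ : (R : ℤ) + 2 ≤ ⌊c * n⌋ - ⌊b * n⌋ := by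
      have h : (R : ℝ) + 2 < ⌊c * n⌋ - ⌊b * n⌋ := by linarith
      have h' : (R : ℤ) + 2 < ⌊c * n⌋ - ⌊b * n⌋ := by exact_mod_cast h
      omega
    have h₃ : ∀ j : ℤ, k ≤ j → 2 * (R : ℤ) + 1 ≤ j - ⌊c * n⌋ := by
      intro j hj
      have h : 2 * (R : ℝ) + 1 < ⌊x₀ * n⌋ - ⌊c * n⌋ := by linarith
      have h' : 2 * (R : ℤ) + 1 < ⌊x₀ * n⌋ - ⌊c * n⌋ := by exact_mod_cast h
      omega
    -- one-step bounds (`arcA a b n = rowIcc ⌊an⌋ ⌊bn⌋` definitionally), from A, I, P of the line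
    have hstep : ∀ j : ℤ, k ≤ j →
        |μ.real (firstHit halfPlane (arcA a b n) ⌊c * n⌋ (j + 1)) -
          μ.real (firstHit halfPlane (arcA a b n) ⌊c * n⌋ j)| ≤ 3 * C_A ^ 2 / (R : ℝ) ^ 2 :=
      fun j hj ↦ Shift.abs_sub_succ_le hC hA stub_symmDiffInclusion stub_isolationIndep
        ⌊a * n⌋ ⌊b * n⌋ ⌊c * n⌋ j R hR1 h₁ h₂ (h₃ j hj)
    have htel := Shift.abs_sub_le_mul_of_succ
      (fun j ↦ μ.real (firstHit halfPlane (arcA a b n) ⌊c * n⌋ j)) hstep m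
    have hD : 3 * C_A ^ 2 / (R : ℝ) ^ 2 ≤ (12 * C_A ^ 2 / ε ^ 2 + (n₀ : ℝ) ^ 2) / (n : ℝ) ^ 2 := by
      have hR2 : ε * n ≤ 2 * R := by linarith
      have hRpos : (0 : ℝ) < R := by linarith
      rw [div_le_div_iff₀ (by positivity) (by positivity)]
      have h4 : (ε * n) ^ 2 ≤ (2 * R) ^ 2 := pow_le_pow_left₀ (by positivity) hR2 2
      have hεne : ε ≠ 0 := hε.ne'
      calc 3 * C_A ^ 2 * (n : ℝ) ^ 2 = 3 * C_A ^ 2 / ε ^ 2 * (ε * n) ^ 2 := by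
            field_simp
        _ ≤ 3 * C_A ^ 2 / ε ^ 2 * (2 * R) ^ 2 := mul_le_mul_of_nonneg_left h4 (by positivity)
        _ = 12 * C_A ^ 2 / ε ^ 2 * (R : ℝ) ^ 2 := by ring
        _ ≤ (12 * C_A ^ 2 / ε ^ 2 + (n₀ : ℝ) ^ 2) * (R : ℝ) ^ 2 :=
          mul_le_mul_of_nonneg_right (le_add_of_nonneg_right (by positivity)) (by positivity)
    calc _ ≤ (m : ℝ) * (3 * C_A ^ 2 / (R : ℝ) ^ 2) := htel
      _ ≤ (m : ℝ) * ((12 * C_A ^ 2 / ε ^ 2 + (n₀ : ℝ) ^ 2) / (n : ℝ) ^ 2) :=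
        mul_le_mul_of_nonneg_left hD (Nat.cast_nonneg m)
      _ = _ := by push_cast; ring

/-! ### Density regularity with a uniform constant -/

/-- **Uniform density regularity.** For every `ε > 0` there is `C ≥ 0` such that for ALL marks with
`4ε ≤ b − a`, `4ε ≤ c − b`, `4ε ≤ x₀ − c`: along every `θ → ∞` on which the CDF converges to `G` on a
window `(x−δ₀, x+δ₀)` with `x₀ ≤ x − δ₀`, the crux's sequence converges to some `ρ`, `G'(x) = ρ` with the
Taylor bounds `|G(x+t) − G x − ρt| ≤ Ct²`, `|G x − G(x−t) − ρt| ≤ Ct²` (`0 < t < δ₀`); and two such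
limits `ρ, ρ'` at `x, x' ≥ x₀` along the same `θ` satisfy `|ρ' − ρ| ≤ C|x' − x|`. [folklore] -/
theorem uniformDensityRegularity {ε : ℝ} (hε : 0 < ε) :
    ∃ C : ℝ, 0 ≤ C ∧ ∀ a b c x₀ : ℝ, 4 * ε ≤ b - a → 4 * ε ≤ c - b → 4 * ε ≤ x₀ - c →
      (∀ (x δ₀ : ℝ), 0 < δ₀ → x₀ ≤ x - δ₀ →
        ∀ θ : ℕ → ℕ, Tendsto θ atTop atTop → ∀ G : ℝ → ℝ,
          (∀ y : ℝ, x - δ₀ < y → y < x + δ₀ →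
            Tendsto (fun j ↦ μ.real (openCrossing halfPlane (arcA a b (θ j))
              (rowIcc ⌊c * (θ j : ℕ)⌋ ⌊y * (θ j : ℕ)⌋))) atTop (𝓝 (G y))) →
          ∃ ρ : ℝ, Tendsto (fun j ↦ lawSeq a b c x (θ j)) atTop (𝓝 ρ) ∧ HasDerivAt G ρ x ∧
            (∀ t : ℝ, 0 < t → t < δ₀ → |G (x + t) - G x - ρ * t| ≤ C * t ^ 2) ∧
            (∀ t : ℝ, 0 < t → t < δ₀ → |G x - G (x - t) - ρ * t| ≤ C * t ^ 2)) ∧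
      (∀ θ : ℕ → ℕ, Tendsto θ atTop atTop → ∀ x x' ρ ρ' : ℝ, x₀ ≤ x → x₀ ≤ x' →
        Tendsto (fun j ↦ lawSeq a b c x (θ j)) atTop (𝓝 ρ) →
        Tendsto (fun j ↦ lawSeq a b c x' (θ j)) atTop (𝓝 ρ') → |ρ' - ρ| ≤ C * |x' - x|) := by
  obtain ⟨C, hC0, hC⟩ := uniformShiftLipschitz hε
  refine ⟨C, hC0, fun a b c x₀ hεab hεbc hεcx ↦ ⟨fun x δ₀ hδ₀ hlo θ hθ G hG ↦ ?_,
    fun θ hθ x x' ρ ρ' h₀ h₀' hρ hρ' ↦ ?_⟩⟩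
  · have hcx : c < x - δ₀ := by linarith
    have hlip : ∀ n : ℕ, 1 ≤ n → ∀ k k' : ℤ, ⌊(x - δ₀) * n⌋ ≤ k → k ≤ k' → k' ≤ ⌊(x + δ₀) * n⌋ →
        |μ.real (firstHit halfPlane (arcA a b n) ⌊c * n⌋ k') -
            μ.real (firstHit halfPlane (arcA a b n) ⌊c * n⌋ k)| ≤ C * (k' - k) / (n : ℝ) ^ 2 := by
      intro n hn k k' h1 h2 _
      have hlo' : ⌊x₀ * (n : ℝ)⌋ ≤ ⌊(x - δ₀) * n⌋ :=
        Int.floor_le_floor (mul_le_mul_of_nonneg_right hlo (Nat.cast_nonneg _))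
      exact hC a b c x₀ hεab hεbc hεcx n hn k k' (hlo'.trans h1) h2
    obtain ⟨ρ, hρ, hD, hR, hL⟩ := tendsto_pointMass_and_hasDerivAt
      (g := fun n k ↦ μ.real (firstHit halfPlane (arcA a b n) ⌊c * n⌋ k))
      (P := fun n y ↦ μ.real (openCrossing halfPlane (arcA a b n) (rowIcc ⌊c * n⌋ ⌊y * n⌋)))
      (G := G) hC0 hδ₀ (windowSums a b c hcx) hlip hθ hG
    exact ⟨ρ, hρ, hD, hR, hL⟩
  · refine abs_sub_le_of_pointMass
      (g := fun n k ↦ μ.real (firstHit halfPlane (arcA a b n) ⌊c * n⌋ k)) hθ ?_ hρ hρ'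
    filter_upwards [eventually_ge_atTop 1] with n hn
    rcases le_total x x' with hxx' | hxx'
    · have hfl : ⌊x * (n : ℝ)⌋ ≤ ⌊x' * n⌋ :=
        Int.floor_le_floor (mul_le_mul_of_nonneg_right hxx' (Nat.cast_nonneg _))
      have h := hC a b c x₀ hεab hεbc hεcx n hn ⌊x * n⌋ ⌊x' * n⌋
        (Int.floor_le_floor (mul_le_mul_of_nonneg_right h₀ (Nat.cast_nonneg _))) hfl
      have habs : |((⌊x' * (n : ℝ)⌋ - ⌊x * (n : ℝ)⌋ : ℤ) : ℝ)| = ((⌊x' * (n : ℝ)⌋ : ℝ) - ⌊x * (n : ℝ)⌋) := by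
        push_cast
        exact abs_of_nonneg (by exact_mod_cast sub_nonneg.2 hfl)
      rw [habs]
      exact h
    · have hfl : ⌊x' * (n : ℝ)⌋ ≤ ⌊x * n⌋ :=
        Int.floor_le_floor (mul_le_mul_of_nonneg_right hxx' (Nat.cast_nonneg _))
      have h := hC a b c x₀ hεab hεbc hεcx n hn ⌊x' * n⌋ ⌊x * n⌋
        (Int.floor_le_floor (mul_le_mul_of_nonneg_right h₀' (Nat.cast_nonneg _))) hfl
      have habs : |((⌊x' * (n : ℝ)⌋ - ⌊x * (n : ℝ)⌋ : ℤ) : ℝ)| = ((⌊x * (n : ℝ)⌋ : ℝ) - ⌊x' * (n : ℝ)⌋) := by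
        push_cast
        rw [abs_sub_comm]
        exact abs_of_nonneg (by exact_mod_cast sub_nonneg.2 hfl)
      rw [habs, abs_sub_comm]
      exact h

/-! ### Joint continuity of the outer-mark derivatives of joint limits -/

/-- Distances in `ℝ × ℝ × ℝ × ℝ` control each coordinate. [folklore] -/
theorem dist_coords_lt {p q : ℝ × ℝ × ℝ × ℝ} {δ : ℝ} (h : dist p q < δ) :
    |p.1 - q.1| < δ ∧ |p.2.1 - q.2.1| < δ ∧ |p.2.2.1 - q.2.2.1| < δ ∧ |p.2.2.2 - q.2.2.2| < δ := by
  simp only [Prod.dist_eq, max_lt_iff, Real.dist_eq] at h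
  exact ⟨h.1, h.2.1, h.2.2.1, h.2.2.2⟩

/-- Moving only the last coordinate to a common value does not increase the distance. [folklore] -/
theorem dist_fix_last_le (a' b' c' x' a b c x u : ℝ) :
    dist ((a', b', c', u) : ℝ × ℝ × ℝ × ℝ) (a, b, c, u) ≤ dist ((a', b', c', x') : ℝ × ℝ × ℝ × ℝ) (a, b, c, x) := by
  simp only [Prod.dist_eq, dist_self]
  exact max_le_max le_rfl (max_le_max le_rfl (max_le_max le_rfl dist_nonneg))

section JointLimit

variable {θ : ℕ → ℕ} {G : ℝ → ℝ → ℝ → ℝ → ℝ}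
  (hG : ∀ a b c y : ℝ, a < b → b < c → c < y →
    Tendsto (fun n ↦ μ.real (openCrossing halfPlane (arcA a b (θ n))
      (rowIcc ⌊c * (θ n : ℕ)⌋ ⌊y * (θ n : ℕ)⌋))) atTop (𝓝 (G a b c y)))
include hG

/-- **The fourth-mark derivative of a joint limit is jointly continuous on the chamber.** For a joint
subsequential limit `G` along a strictly increasing `θ`, `(a,b,c,x) ↦ ∂₄G(a,b,c,x)` — the limit along
`θ` of the crux's sequence `lawSeq a b c x` — is continuous on `{a < b < c < x}`. [folklore] -/
theorem continuousOn_deriv₄_jointLimit (hθ : StrictMono θ) :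
    ContinuousOn (fun p : ℝ × ℝ × ℝ × ℝ ↦ deriv (G p.1 p.2.1 p.2.2.1) p.2.2.2)
      {p | p.1 < p.2.1 ∧ p.2.1 < p.2.2.1 ∧ p.2.2.1 < p.2.2.2} := by
  rw [Metric.continuousOn_iff]
  rintro ⟨a, b, c, x⟩ ⟨hab, hbc, hcx⟩ η hη
  dsimp only at hab hbc hcx ⊢
  -- the separation scale `ε`: `8ε = min (b − a, c − b, x − c)`
  obtain ⟨ε, hε, hεab, hεbc, hεcx⟩ : ∃ ε : ℝ, 0 < ε ∧ 8 * ε ≤ b - a ∧ 8 * ε ≤ c - b ∧ 8 * ε ≤ x - c := by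
    refine ⟨min (min (b - a) (c - b)) (x - c) / 8, ?_, ?_, ?_, ?_⟩
    · have : 0 < min (min (b - a) (c - b)) (x - c) :=
        lt_min (lt_min (by linarith) (by linarith)) (by linarith)
      positivity
    · have : min (min (b - a) (c - b)) (x - c) ≤ b - a := (min_le_left _ _).trans (min_le_left _ _)
      linarith
    · have : min (min (b - a) (c - b)) (x - c) ≤ c - b := (min_le_left _ _).trans (min_le_right _ _)
      linarith
    · have : min (min (b - a) (c - b)) (x - c) ≤ x - c := min_le_right _ _
      linarith
  obtain ⟨C, hC0, hU⟩ := uniformDensityRegularity hε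
  -- joint continuity of `G` (c2-0)
  have hGc := Subseq.continuousOn_of_jointLimit hG hθ
  rw [Metric.continuousOn_iff] at hGc
  -- the step `t` with `2Ct ≤ η/4`, `t ≤ ε/2`, and the tolerance `κ = ηt/16`
  obtain ⟨t, ht0, htε, htη⟩ : ∃ t : ℝ, 0 < t ∧ t ≤ ε / 2 ∧ 2 * C * t ≤ η / 4 := by
    refine ⟨min (ε / 2) (η / (8 * (C + 1))), by positivity, min_le_left _ _, ?_⟩
    have h1 : min (ε / 2) (η / (8 * (C + 1))) ≤ η / (8 * (C + 1)) := min_le_right _ _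
    have h2 : C * (η / (8 * (C + 1))) ≤ η / 8 := by
      rw [mul_div_assoc', div_le_div_iff₀ (by positivity) (by positivity)]
      nlinarith
    have h3 : C * min (ε / 2) (η / (8 * (C + 1))) ≤ C * (η / (8 * (C + 1))) :=
      mul_le_mul_of_nonneg_left h1 hC0
    linarith only [h2, h3]
  set κ : ℝ := η * t / 16 with hκ_def
  have hκ0 : 0 < κ := by rw [hκ_def]; positivity
  obtain ⟨δ₁, hδ₁, h₁⟩ := hGc (a, b, c, x + t) ⟨hab, hbc, show c < x + t by linarith only [hcx, ht0]⟩ κ hκ0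
  obtain ⟨δ₂, hδ₂, h₂⟩ := hGc (a, b, c, x) ⟨hab, hbc, hcx⟩ κ hκ0
  -- the radius `δ`
  obtain ⟨δ, hδ, hδ₁', hδ₂', hδε, hδη⟩ : ∃ δ : ℝ, 0 < δ ∧ δ ≤ δ₁ ∧ δ ≤ δ₂ ∧ δ ≤ ε / 2 ∧
      C * δ ≤ η / 4 := by
    refine ⟨min (min δ₁ δ₂) (min (ε / 2) (η / (4 * (C + 1)))), by positivity,
      (min_le_left _ _).trans (min_le_left _ _), (min_le_left _ _).trans (min_le_right _ _),
      (min_le_right _ _).trans (min_le_left _ _), ?_⟩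
    have h1 : min (min δ₁ δ₂) (min (ε / 2) (η / (4 * (C + 1)))) ≤ η / (4 * (C + 1)) :=
      (min_le_right _ _).trans (min_le_right _ _)
    have h2 : C * (η / (4 * (C + 1))) ≤ η / 4 := by
      rw [mul_div_assoc', div_le_div_iff₀ (by positivity) (by positivity)]
      nlinarith
    have h3 := mul_le_mul_of_nonneg_left h1 hC0
    linarith only [h2, h3]
  refine ⟨δ, hδ, ?_⟩
  rintro ⟨a', b', c', x'⟩ ⟨hab', hbc', hcx'⟩ hd
  dsimp only at hab' hbc' hcx' ⊢
  obtain ⟨hda, hdb, hdc, hdx⟩ := dist_coords_lt (hd.trans_le hδε)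
  dsimp only at hda hdb hdc hdx
  obtain ⟨hda1, hda2⟩ := abs_lt.1 hda
  obtain ⟨hdb1, hdb2⟩ := abs_lt.1 hdb
  obtain ⟨hdc1, hdc2⟩ := abs_lt.1 hdc
  obtain ⟨hdx1, hdx2⟩ := abs_lt.1 hdx
  have hdxδ : |x' - x| < δ := (dist_coords_lt hd).2.2.2
  -- the primed and unprimed marks are `4ε`-separated with `x₀ = x − ε`
  have hc'x : c' < x - ε := by linarith only [hdc2, hεcx, hε]
  obtain ⟨hT', hL'⟩ := hU a' b' c' (x - ε) (by linarith only [hda2, hdb1, hεab, hε])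
    (by linarith only [hdb2, hdc1, hεbc, hε]) (by linarith only [hdc2, hεcx, hε])
  obtain ⟨hT, -⟩ := hU a b c (x - ε) (by linarith only [hεab, hε]) (by linarith only [hεbc, hε])
    (by linarith only [hεcx, hε])
  -- the three density limits involved
  have hρ := hasDerivAt_jointLimit hG hθ.tendsto_atTop hab hbc hcx
  have hρ' := hasDerivAt_jointLimit hG hθ.tendsto_atTop hab' hbc' (show c' < x by linarith only [hc'x, hε])
  have hρ'' := hasDerivAt_jointLimit hG hθ.tendsto_atTop hab' hbc' hcx'
  -- (1) Lipschitz in the fourth mark at the primed marks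
  have hstep1 : |deriv (G a' b' c') x' - deriv (G a' b' c') x| ≤ η / 4 := by
    have h := hL' θ hθ.tendsto_atTop x x' _ _ (by linarith only [hε])
      (by linarith only [hdx1, hε]) hρ'.2 hρ''.2
    have h' : C * |x' - x| ≤ C * δ := mul_le_mul_of_nonneg_left hdxδ.le hC0
    linarith only [h, h', hδη]
  -- (2) Taylor bounds at `x` with step `t`
  obtain ⟨ρ₁, -, hD₁, hR₁, -⟩ := hT' x ε hε le_rfl θ hθ.tendsto_atTop (G a' b' c')
    (fun y hy _ ↦ hG a' b' c' y hab' hbc' (by linarith only [hy, hc'x]))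
  obtain ⟨ρ₀, -, hD₀, hR₀, -⟩ := hT x ε hε le_rfl θ hθ.tendsto_atTop (G a b c)
    (fun y hy _ ↦ hG a b c y hab hbc (by linarith only [hy, hεcx, hε]))
  have hTay₁ := hR₁ t ht0 (by linarith only [htε, hε])
  have hTay₀ := hR₀ t ht0 (by linarith only [htε, hε])
  rw [hD₁.unique hρ'.1] at hTay₁
  rw [hD₀.unique hρ.1] at hTay₀
  -- (3) joint continuity of `G` at `(a,b,c,x+t)` and `(a,b,c,x)`
  have hG₁ : |G a' b' c' (x + t) - G a b c (x + t)| < κ := by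
    rw [← Real.dist_eq]
    exact h₁ (a', b', c', x + t) ⟨hab', hbc', show c' < x + t by linarith only [hc'x, hε, ht0]⟩
      ((dist_fix_last_le a' b' c' x' a b c x (x + t)).trans_lt (hd.trans_le hδ₁'))
  have hG₂ : |G a' b' c' x - G a b c x| < κ := by
    rw [← Real.dist_eq]
    exact h₂ (a', b', c', x) ⟨hab', hbc', show c' < x by linarith only [hc'x, hε]⟩
      ((dist_fix_last_le a' b' c' x' a b c x x).trans_lt (hd.trans_le hδ₂'))
  -- (4) `|ρ(q',x) − ρ(q,x)| · t ≤ 2κ + 2Ct² ≤ (η/2) t`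
  have hstep2 : |deriv (G a' b' c') x - deriv (G a b c) x| ≤ η / 2 := by
    set X : ℝ := deriv (G a' b' c') x - deriv (G a b c) x with hX
    have key : X * t = (G a' b' c' (x + t) - G a b c (x + t)) - (G a' b' c' x - G a b c x)
        - (G a' b' c' (x + t) - G a' b' c' x - deriv (G a' b' c') x * t)
        + (G a b c (x + t) - G a b c x - deriv (G a b c) x * t) := by rw [hX]; ring
    have e0 : |X| * t = |X * t| := by rw [abs_mul, abs_of_pos ht0]
    have hsub : ∀ u v : ℝ, |u - v| ≤ |u| + |v| := fun u v ↦ by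
      simpa only [sub_eq_add_neg, abs_neg] using abs_add_le u (-v)
    have e1 := abs_add_le
      ((G a' b' c' (x + t) - G a b c (x + t)) - (G a' b' c' x - G a b c x)
        - (G a' b' c' (x + t) - G a' b' c' x - deriv (G a' b' c') x * t))
      (G a b c (x + t) - G a b c x - deriv (G a b c) x * t)
    have e2 := hsub
      ((G a' b' c' (x + t) - G a b c (x + t)) - (G a' b' c' x - G a b c x))
      (G a' b' c' (x + t) - G a' b' c' x - deriv (G a' b' c') x * t)
    have e3 := hsub (G a' b' c' (x + t) - G a b c (x + t)) (G a' b' c' x - G a b c x)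
    have h1 : |X| * t ≤ 2 * κ + 2 * C * t ^ 2 := by
      rw [e0, key]
      linarith only [e1, e2, e3, hG₁, hG₂, hTay₁, hTay₀]
    have h2 : 2 * κ + 2 * C * t ^ 2 ≤ (η / 2) * t := by
      have : 2 * κ + 2 * C * t ^ 2 = t * (η / 8 + 2 * C * t) := by rw [hκ_def]; ring
      rw [this, mul_comm (η / 2) t]
      exact mul_le_mul_of_nonneg_left (by linarith only [htη, hη]) ht0.le
    exact le_of_mul_le_mul_right (h1.trans h2) ht0
  -- conclusion
  rw [Real.dist_eq]
  have e := abs_sub_le (deriv (G a' b' c') x') (deriv (G a' b' c') x) (deriv (G a b c) x)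
  linarith only [e, hstep1, hstep2, hη]

/-- **The first-mark derivative of a joint limit is jointly continuous on the chamber**
(`∂₁G(a,b,c,y) = −∂₄G(−y,−c,−b,−a)` by `hasDerivAt_jointLimit_first`, and the reflection
`(a,b,c,y) ↦ (−y,−c,−b,−a)` maps the chamber continuously to itself). [folklore] -/
theorem continuousOn_deriv₁_jointLimit (hθ : StrictMono θ) :
    ContinuousOn (fun p : ℝ × ℝ × ℝ × ℝ ↦ deriv (fun s ↦ G s p.2.1 p.2.2.1 p.2.2.2) p.1)
      {p | p.1 < p.2.1 ∧ p.2.1 < p.2.2.1 ∧ p.2.2.1 < p.2.2.2} := by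
  have h4 := continuousOn_deriv₄_jointLimit hG hθ
  have hrefl : ContinuousOn (fun p : ℝ × ℝ × ℝ × ℝ ↦ ((-p.2.2.2, -p.2.2.1, -p.2.1, -p.1) : ℝ × ℝ × ℝ × ℝ))
      {p : ℝ × ℝ × ℝ × ℝ | p.1 < p.2.1 ∧ p.2.1 < p.2.2.1 ∧ p.2.2.1 < p.2.2.2} := by fun_prop
  have hmaps : MapsTo (fun p : ℝ × ℝ × ℝ × ℝ ↦ ((-p.2.2.2, -p.2.2.1, -p.2.1, -p.1) : ℝ × ℝ × ℝ × ℝ))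
      {p | p.1 < p.2.1 ∧ p.2.1 < p.2.2.1 ∧ p.2.2.1 < p.2.2.2}
      {p | p.1 < p.2.1 ∧ p.2.1 < p.2.2.1 ∧ p.2.2.1 < p.2.2.2} := by
    rintro ⟨a, b, c, y⟩ ⟨hab, hbc, hcy⟩
    dsimp only at hab hbc hcy ⊢
    exact ⟨by linarith, by linarith, by linarith⟩
  have hcomp := (h4.comp hrefl hmaps).neg
  refine hcomp.congr ?_
  rintro ⟨a, b, c, y⟩ ⟨hab, hbc, hcy⟩
  dsimp only at hab hbc hcy
  show deriv (fun s ↦ G s b c y) a = -deriv (G (-y) (-c) (-b)) (-a)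
  exact (hasDerivAt_jointLimit_first hG hθ hab hbc hcy).1.deriv

end JointLimit

/-- **Registered extra stub of line `Sketch` (lead c4-0): joint continuity of the fourth-mark
derivative of the joint subsequential limits**, closed form of `continuousOn_deriv₄_jointLimit`.
[folklore] -/
theorem stub_jointContinuityDeriv4 :
    ∀ θ : ℕ → ℕ, StrictMono θ → ∀ G : ℝ → ℝ → ℝ → ℝ → ℝ,
      (∀ a b c y : ℝ, a < b → b < c → c < y →
        Tendsto (fun n ↦ μ.real (openCrossing halfPlane (arcA a b (θ n))
          (rowIcc ⌊c * (θ n : ℕ)⌋ ⌊y * (θ n : ℕ)⌋))) atTop (𝓝 (G a b c y))) →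
      ContinuousOn (fun p : ℝ × ℝ × ℝ × ℝ ↦ deriv (G p.1 p.2.1 p.2.2.1) p.2.2.2)
        {p | p.1 < p.2.1 ∧ p.2.1 < p.2.2.1 ∧ p.2.2.1 < p.2.2.2} :=
  fun _ hθ _ hG ↦ continuousOn_deriv₄_jointLimit hG hθ

end Density

end Summit.CriticalPhenomena.CardyFormulaZ2.Cruxes.HalfPlaneMarkDensityLaw.SketchLine
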